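import Literature.MathematicalPhysics.QuantumFieldTheory.Balaban1983to89.B8Prop5UniqueZdLan
import Literature.MathematicalPhysics.QuantumFieldTheory.Balaban1983to89.B8CubeMemberZd

/-!
# `Balaban1983to89.B8Prop5LandauIdxLayer` — PRINT'S LAYER LAW (1.5) FOR THE PROPOSITION-5 INDEX: the canonical index of Proposition-5 data
# `B8Prop5LandauDataZd.ZdLanIdx` cut by a FOURTH law «the constraint towers `Bʲ(y)`, `y ∈ Λ_j`, `j ≤ k`, are pairwise DISJOINT» (print (1.5)
# `Λ_j := Ω_j^{(j)} ∖ Ω_{j+1}^{(j)}`), which EXCLUDES the datum `Λ₀ = Λ₁ = ℤᵈ` at which referee ref-A (g15 READ-23, 2026-08-27) found the [4]-letters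
# binder `SLetL` of the three-law index `…Sub3` unsatisfiable; Proposition 5 ∃ ∕ ! over the four-law index BY NAME, and its inhabitation

statement-level skeleton of published theorems with citation tags; proofs where landed; nothing here is a claim about the Yang–Mills mass gap

T. Bałaban, *Spaces of regular gauge field configurations on a lattice and gauge fixing conditions*, Commun. Math. Phys. **99** (1985) 75–102
`[Balaban1985RegularSpaces]` ("B8"; journal page = PDF page + 74): p. 77 (1.5) «Λ_j = Ω_j^{(j)} ∖ Ω_{j+1}^{(j)}, j = 0, 1, …, k − 1, Λ_k = Ω_k^{(k)}»,
(1.6), p. 77 «we admit the case where some domains Ω_j are equal to T_η»; Prop. 5 (1.107)–(1.109) p. 94; (1.91)–(1.92) p. 91 (`Q′H′ = I`); [4] = T. Bałaban,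
*Propagators for lattice gauge theories in a background field*, CMP **99** (1985) 389–434, p. 81∕p. 394 (the structure `𝔅_k`), Thm 3.1 p. 397.

## WHY THIS FILE (cell `pub-ymgap`, HUMAN RULING D-0062; R134 seat `pub-ymgap-dag-n05-c` g5, DAG node N05 = [B8]; definition lane, count-neutral)

The Proposition-5 knits of record read Prop. 5's index as a free `ι : J → ZdLanIdx` with three member laws («`Ω₀ = ℤᵈ`», «`Ω_{j+1} ⊂ Ω_j`», «towers ⊂ Ω_j»);
this seat's g3 v1.4 (`B8Prop5ExistsZdLan.prop5Exists_zdLanSub3_of_lettersRD`) and n05-d's twins fixed the CANONICAL `J` = the three-law subtype.  ref-A g15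
READ-23 (kernel `sletL_sub3_unsatisfiable`): at the datum `η = 1, k = 1, Ω = Λ = univ, U₀ = 1` (a member of that subtype) the letters binder `SLetL` is
UNSATISFIABLE — the letter `H′` must satisfy `Q′₀(H′Y)(y) = Y(0, y)` at every site (Λ₀ = ℤᵈ: `H′Y = Y(0, ·)`) AND `Q′₁(H′Y)(y) = Y(1, y)` on every 1-block,
contradictory for `Y` with inconsistent levels — so every `…Sub3` face is vacuous.  ROOT CAUSE: the three laws do not carry print's (1.5): the constraint sets
`Λ_j` of different levels live on DISJOINT towers.  THIS FILE types that law for `ZdLanIdx` as «pairwise disjointness of the towers `{Bʲ(y) : j ≤ k, y ∈ Λ_j}`»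
(`TowerDisjoint`; exactly what makes the constraints `Q′_j(H′Y)(y) = Y(j, y)` independent), cuts the canonical index by it (`ZdLanIdxSub4`), shows the cut is
INHABITED (the depth-one LamTop datum `Λ₀ = ∅, Λ₁ = ℤᵈ^{(1)}`) and EXCLUDES ref-A's witness, and restates Proposition 5 ∃ (this seat's ι-generic theorem) and
! (n05-d's) over the four-law index — so an ∃-currency closer has a sound canonical `J` again.

## WHAT IS DECLARED ∕ PROVED (kernel, 0 sorry; axioms `propext` ∕ `Classical.choice` ∕ `Quot.sound`)

* §1 **`ZdLanIdx.TowerDisjoint L i`** (definition: a site under two constraint towers forces equal level and label), `towerDisjoint_iff_flm` (unfolding through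
  the floor map), **`ZdLanIdxSub4 d 𝔸 L`** (definition: the four-law subtype), `ZdLanIdxSub4.laws` (the four laws by name), `ZdLanIdxSub4.toSub3`
  (forget the fourth law).
* §2 **`nonempty_zdLanIdxSub4`** (the LamTop datum of depth one), ★ `not_towerDisjoint_of_nested` (two constrained towers of different levels through one site
  violate the law) and **`not_towerDisjoint_univ_univ`** (ref-A's witness shape `Λ₀ ∋ y₀`, `Λ₁ ∋ y₁` with `y₀` in the 1-block of `y₁` is EXCLUDED).
* §3 **`prop5Exists_zdLanSub4_of_lettersRD`** (`B8.Prop5Exists B₀′ B₁ (zdLan L B₁ ∘ val)` over the four-law index, from the RD letters at its members — this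
  seat's `prop5Exists_zdLan_of_lettersRD` at `ι := Subtype.val`), **`prop5Unique_zdLanSub4_of_lettersUB`** (n05-d's `prop5Unique_zdLan_of_lettersUB` likewise).

## HONEST SCOPE

A typing law + bookkeeping by name; whether [4]'s letters EXIST at the four-law members (satisfiability of `SLetL`∕`SLetLU` there) is [Balaban1985BackgroundPropagators]
Thm 3.1's business (N06 lineage) — this file only removes the located obstruction.  Count-neutral; N05 NOT discharged; `T_η ↦ ℤᵈ`; one finite `T⁴` programme at
fixed `ε`, Bałaban as printed — nothing continuum ∕ ℝ⁴ ∕ OS ∕ mass-gap ∕ Clay.  No `sorry`, no `instance`, no `notation`.  Unit `pub-ymgap-dag-n05-c` (g5), 2026-08-27.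

[cite: Balaban1985RegularSpaces, (1.5)–(1.6) p.77, p.77 («Ω_j = T_η»), Prop. 5 (1.107)–(1.109) p.94, (1.91)–(1.92) p.91; Balaban1985BackgroundPropagators, p.394 (`𝔅_k`), Thm 3.1 p.397]
-/

noncomputable section

open NormedSpace

namespace Literature.MathematicalPhysics.QuantumFieldTheory.Balaban1983to89.B8Prop5LandauIdxLayer

open B7Prop1Explicit B7Prop2Explicit B7Prop1Local
open B7Eq78Linearization (zdBlocking QprimeIter)
open B8Ineq132 (covDerivFwd InAk Under)
open B8Eq119TwistedAxial (bgT)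
open B8Eq140Level (SideTouches)
open B8Ineq130 (tlo thi)
open B8Eq138LandauZd (covLap QT)
open B8Eq1117Concrete (XSpace)
open B8Prop5ContractionKLevel (Bd2)
open B8LambdaSpaceKLevel (wt)
open B8Prop5LandauDataZd (ZdLanIdx zdLan)
open B8Prop5ExistsZdLan (prop5Exists_zdLan_of_lettersRD)
open B8Prop5UniqueZdLan (prop5Unique_zdLan_of_lettersUB)
open B8Eq131Cubes (flm under_flm)
open B8CubeMemberZd (inBox_tower_iff_under)
open Literature.MathematicalPhysics.QuantumLattice (blockMap blockSites mem_blockSites_iff)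

-- `Site` alone could resolve to the torus sites of `Setup.lean`; re-export the `ℤ^d` sites of `B7Prop1Explicit`.
export B7Prop1Explicit (Site)

variable {d : ℕ} {𝔸 : Type} [CStarAlgebra 𝔸]

/-! ## §1 The layer law and the four-law canonical index -/

section Law

/-- **PRINT'S LAYER LAW (1.5) for a Proposition-5 datum**: the constraint towers `Bʲ(y) = {x : tlo_j(y) ≤ x ≤ thi_j(y)}`, `y ∈ Λ_j`, `j ≤ k`, are PAIRWISE
DISJOINT — a site under two of them forces the same level and the same label.  (Print: `Λ_j = Ω_j^{(j)} ∖ Ω_{j+1}^{(j)}` for `j < k`, `Λ_k = Ω_k^{(k)}`, so the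
towers of 𝔅_k partition; this is the disjointness half, the one the letter `H′` with `Q′_j(H′Y)(y) = Y(j, y)` needs.)
[cite: Balaban1985RegularSpaces, (1.5) p.77; Balaban1985BackgroundPropagators, p.394 (𝔅_k)] -/
def _root_.Literature.MathematicalPhysics.QuantumFieldTheory.Balaban1983to89.B8Prop5LandauDataZd.ZdLanIdx.TowerDisjoint (L : ℕ) (i : ZdLanIdx d 𝔸) : Prop :=
  ∀ (j j' : ℕ) (y y' x : Site d), j ≤ i.k → j' ≤ i.k → y ∈ i.Λ j → y' ∈ i.Λ j' →
    InBox (tlo L y j) (thi L y j) x → InBox (tlo L y' j') (thi L y' j') x → j = j' ∧ y = y'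

/-- **THE FOUR-LAW CANONICAL INDEX OF PROPOSITION-5 DATA**: `Ω₀ = ℤᵈ`, `Ω_{j+1} ⊂ Ω_j`, towers `⊂ Ω_j`, and the layer law `TowerDisjoint`.
[cite: Balaban1985RegularSpaces, (1.3)–(1.6) p.77, Prop. 5 p.94] -/
def ZdLanIdxSub4 (d : ℕ) (𝔸 : Type) [CStarAlgebra 𝔸] (L : ℕ) : Type :=
  {i : ZdLanIdx d 𝔸 // i.Ω 0 = Set.univ ∧ (∀ j, i.Ω (j + 1) ⊆ i.Ω j) ∧
    (∀ j, j ≤ i.k → ∀ y ∈ i.Λ j, ∀ x, InBox (tlo L y j) (thi L y j) x → x ∈ i.Ω j) ∧ i.TowerDisjoint L}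

variable {L : ℕ}

/-- The four laws of a member of the four-law index, by name. [cite: Balaban1985RegularSpaces, (1.3)–(1.6) p.77 (bookkeeping)] -/
theorem ZdLanIdxSub4.laws (a : ZdLanIdxSub4 d 𝔸 L) :
    a.1.Ω 0 = Set.univ ∧ (∀ j, a.1.Ω (j + 1) ⊆ a.1.Ω j) ∧
      (∀ j, j ≤ a.1.k → ∀ y ∈ a.1.Λ j, ∀ x, InBox (tlo L y j) (thi L y j) x → x ∈ a.1.Ω j) ∧ a.1.TowerDisjoint L :=
  a.2

/-- Forget the layer law: a four-law member is a three-law member (the index of `B8Prop5ExistsZdLan.prop5Exists_zdLanSub3_of_lettersRD`).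
[cite: Balaban1985RegularSpaces, (1.3)–(1.6) p.77 (bookkeeping)] -/
def ZdLanIdxSub4.toSub3 (a : ZdLanIdxSub4 d 𝔸 L) :
    {i : ZdLanIdx d 𝔸 // i.Ω 0 = Set.univ ∧ (∀ j, i.Ω (j + 1) ⊆ i.Ω j) ∧
      ∀ j, j ≤ i.k → ∀ y ∈ i.Λ j, ∀ x, InBox (tlo L y j) (thi L y j) x → x ∈ i.Ω j} :=
  ⟨a.1, a.2.1, a.2.2.1, a.2.2.2.1⟩

/-- `toSub3` keeps the datum (`rfl`). [cite: Balaban1985RegularSpaces, p.77 (bookkeeping)] -/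
theorem ZdLanIdxSub4.toSub3_val (a : ZdLanIdxSub4 d 𝔸 L) : (ZdLanIdxSub4.toSub3 a).1 = a.1 := rfl

end Law

/-! ## §2 Inhabitation by the depth-one LamTop datum; ref-A's witness is excluded -/

section Members

variable {L : ℕ}

/-- Two sites under the same level-`1` tower label have that label as their `L`-block (`B8Thm4TruncationLocal.mem_blockSites_of_under_one`): labels of
level-one towers through a common site coincide. [cite: Balaban1985RegularSpaces, (1.5) p.77 (bookkeeping)] -/
theorem label_eq_of_under_one (hL : 1 ≤ L) {y y' x : Site d} (hy : InBox (tlo L y 1) (thi L y 1) x) (hy' : InBox (tlo L y' 1) (thi L y' 1) x) :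
    y = y' := by
  haveI : NeZero L := ⟨by omega⟩
  have h1 := (mem_blockSites_iff L y x).1 (B8Thm4TruncationLocal.mem_blockSites_of_under_one ((inBox_tower_iff_under L 1 y x).1 hy))
  have h2 := (mem_blockSites_iff L y' x).1 (B8Thm4TruncationLocal.mem_blockSites_of_under_one ((inBox_tower_iff_under L 1 y' x).1 hy'))
  rw [← h1, ← h2]

/-- **THE FOUR-LAW INDEX IS INHABITED**: the depth-one LamTop datum (`η = 1`, `k = 1`, `Ω_j = ℤᵈ`, `Λ₀ = ∅`, `Λ₁ = ℤᵈ^{(1)}`, `U₀ = 1`) — print's admitted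
«Ω_j = T_η» with (1.5): `Λ₀ = Ω₀^{(0)} ∖ Ω₁^{(0)} = ∅`, `Λ₁ = Ω₁^{(1)}`; its level-one towers are the `L`-blocks, pairwise disjoint.
[cite: Balaban1985RegularSpaces, (1.5) p.77, p.77 («Ω_j = T_η»)] -/
theorem nonempty_zdLanIdxSub4 (hL : 1 ≤ L) : Nonempty (ZdLanIdxSub4 d 𝔸 L) := by
  classical
  let Lam : ℕ → Set (Site d) := fun j => if j = 1 then Set.univ else ∅
  let i₀ : ZdLanIdx d 𝔸 :=
    { η := 1, hη := one_pos, k := 1, hk := le_rfl, Ω := fun _ => Set.univ, Λ := Lam, U₀ := 1,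
      hU₀ := fun _ _ => (unitaryUnits 𝔸).one_mem }
  refine ⟨⟨i₀, rfl, fun _ => subset_rfl, fun _ _ _ _ x _ => Set.mem_univ x, ?_⟩⟩
  intro j j' y y' x hj hj' hy hy' hx hx'
  change y ∈ Lam j at hy
  change y' ∈ Lam j' at hy'
  have hj1 : j = 1 := by
    by_contra h
    simp only [Lam, h, if_false, Set.mem_empty_iff_false] at hy
  have hj1' : j' = 1 := by
    by_contra h
    simp only [Lam, h, if_false, Set.mem_empty_iff_false] at hy'
  subst hj1; subst hj1'
  exact ⟨rfl, label_eq_of_under_one hL hx hx'⟩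

/-- **Two constrained towers of DIFFERENT levels through one site violate the layer law** (the mechanism of ref-A's `sletL_sub3_unsatisfiable`: a site constrained
at levels `0` and `1` at once). [cite: Balaban1985RegularSpaces, (1.5) p.77] -/
theorem not_towerDisjoint_of_nested {i : ZdLanIdx d 𝔸} {j j' : ℕ} (hjj' : j ≠ j') (hj : j ≤ i.k) (hj' : j' ≤ i.k) {y y' x : Site d}
    (hy : y ∈ i.Λ j) (hy' : y' ∈ i.Λ j') (hx : InBox (tlo L y j) (thi L y j) x) (hx' : InBox (tlo L y' j') (thi L y' j') x) :
    ¬ i.TowerDisjoint L := fun h => hjj' (h j j' y y' x hj hj' hy hy' hx hx').1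

/-- **ref-A's witness shape is EXCLUDED**: a datum with `k ≥ 1` whose `Λ₀` and `Λ₁` are both ALL of `ℤᵈ` (e.g. the three-law witness `Ω = Λ = univ`) violates the
layer law — the site `0` lies under the level-`0` tower of `0 ∈ Λ₀` and under the level-`1` tower of `0 ∈ Λ₁`. [cite: Balaban1985RegularSpaces, (1.5) p.77] -/
theorem not_towerDisjoint_univ_univ (hL : 1 ≤ L) {i : ZdLanIdx d 𝔸} (h0 : i.Λ 0 = Set.univ) (h1 : i.Λ 1 = Set.univ) : ¬ i.TowerDisjoint L := by
  have hflm : ∀ m, flm L m (0 : Site d) = 0 := fun m => by funext ii; simp [flm]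
  have hx0 : InBox (tlo L (0 : Site d) 0) (thi L 0 0) 0 :=
    (inBox_tower_iff_under L 0 0 0).2 (by have h := under_flm (d := d) hL 0 (0 : Site d); rwa [hflm 0] at h)
  have hx1 : InBox (tlo L (0 : Site d) 1) (thi L 0 1) 0 :=
    (inBox_tower_iff_under L 1 0 0).2 (by have h := under_flm (d := d) hL 1 (0 : Site d); rwa [hflm 1] at h)
  exact not_towerDisjoint_of_nested (L := L) zero_ne_one (Nat.zero_le _) i.hk (by rw [h0]; trivial) (by rw [h1]; trivial) hx0 hx1

end Members

/-! ## §3 Proposition 5 ∃ ∕ ! over the four-law index, BY NAME -/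

section Prop5

variable [Nontrivial 𝔸]

/-- **PROPOSITION 5, EXISTENCE CLAUSE, OVER THE FOUR-LAW CANONICAL INDEX** — this seat's `prop5Exists_zdLan_of_lettersRD` at `ι := Subtype.val`; hypotheses:
`d, L ≥ 2`, `2 ≤ B₁`, the free-constant condition, and [4]'s RD letters at every member (below `c_L`).  The fourth law is not read by the existence proof; it is
what makes the letters binder satisfiable in principle (ref-A READ-23). [cite: Balaban1985RegularSpaces, Prop. 5 (1.107)–(1.108) p.94, (1.5) p.77, p.89] -/
theorem prop5Exists_zdLanSub4_of_lettersRD (hd2 : 2 ≤ d) {L : ℕ} (hL : 2 ≤ L) {B₁ B₀' B₀'H B₂' BG BR cL : ℝ}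
    (hB₁ : 2 ≤ B₁) (hB₀' : 0 < B₀') (hBH : 0 < B₀'H) (hB₂ : 0 ≤ B₂') (hBG : 0 ≤ BG) (hBR : 0 ≤ BR) (hcL : 0 < cL)
    (hfree : 3 * (2 * (d : ℝ) * (L : ℝ) ^ 2) * BG * BR ≤ B₀' / 2)
    (SLet : ∀ i : ZdLanIdxSub4 d 𝔸 L,
      ∀ α₀ : ℝ, 0 < α₀ → α₀ ≤ cL → InAk L i.1.k i.1.η α₀ i.1.Ω i.1.U₀ →
      ∃ (g Δ : (Site d → 𝔸) →ₗ[ℂ] (Site d → 𝔸)) (q : (Site d → 𝔸) →ₗ[ℂ] (ℕ → Site d → 𝔸)) (qs : (ℕ → Site d → 𝔸) →ₗ[ℂ] (Site d → 𝔸))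
        (Aw c : (ℕ → Site d → 𝔸) →ₗ[ℂ] (ℕ → Site d → 𝔸)) (H' : XSpace d i.1.k 𝔸 →ₗ[ℂ] (Site d → 𝔸)),
        (∀ x, ∀ y ∈ i.1.Ω 0, (Δ (g x) + qs (Aw (q (g x)))) y = x y) ∧ (∀ f, q (g (g (qs (c (q f))))) = q f) ∧
        (∀ (f : Site d → 𝔸), ∀ x ∈ i.1.Ω 0, Δ f x = covLap i.1.η i.1.U₀ ((i.1.Ω 0).indicator f) x) ∧
        (∀ (μ : ℕ → Site d → 𝔸), ∀ x ∈ i.1.Ω 0, qs μ x = QT L i.1.k i.1.Λ i.1.U₀ μ x) ∧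
        (∀ (f : Site d → 𝔸) (j : ℕ), j ≤ i.1.k → ∀ y ∈ i.1.Λ j, q f j y = QprimeIter (zdBlocking d L) (bgT L i.1.U₀) j f y) ∧
        (∀ (X : XSpace d i.1.k 𝔸) (x : Site d), ‖H' X x‖ ≤ B₀'H * ‖X‖) ∧
        (∀ j, j ≤ i.1.k → ∀ (X : XSpace d i.1.k 𝔸), ∀ p ∈ {b : Site d × Fin d | SideTouches (i.1.Ω j) b.1 b.2},
          wt L i.1.η j * ‖covDerivFwd i.1.η i.1.U₀ p.2 (H' X) p.1‖ ≤ B₀'H * ‖X‖) ∧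
        (∀ X : XSpace d i.1.k 𝔸, Bd2 L i.1.η i.1.k i.1.Ω (covLap i.1.η i.1.U₀ (H' X)) (B₂' * ‖X‖)) ∧
        (∀ (X : XSpace d i.1.k 𝔸) (x : Site d), x ∉ i.1.Ω 0 → H' X x = 0) ∧
        (∀ X Y : XSpace d i.1.k 𝔸, (∀ p, Y p = -star (X p)) → ∀ x, H' Y x = -star (H' X x)) ∧
        (∀ (Y : XSpace d i.1.k 𝔸) (j : ℕ) (hj : j ≤ i.1.k) (y : Site d), y ∈ i.1.Λ j →
          QprimeIter (zdBlocking d L) (bgT L i.1.U₀) j (H' Y) y = Y (⟨j, Nat.lt_succ_of_le hj⟩, y)) ∧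
        (∀ (f : Site d → 𝔸) (r : ℝ), 0 ≤ r → Bd2 L i.1.η i.1.k i.1.Ω f r →
          (∀ x, ‖g f x‖ ≤ BG * r) ∧ ∀ j, j ≤ i.1.k → ∀ p ∈ {b : Site d × Fin d | SideTouches (i.1.Ω j) b.1 b.2},
            wt L i.1.η j * ‖covDerivFwd i.1.η i.1.U₀ p.2 (g f) p.1‖ ≤ BG * r) ∧
        (∀ (f : Site d → 𝔸) (x : Site d), x ∉ i.1.Ω 0 → g f x = 0) ∧
        (∀ f : Site d → 𝔸, (∀ j, j ≤ i.1.k → ∀ x ∈ i.1.Ω j, IsSelfAdjoint (f x)) → ∀ x, IsSelfAdjoint (g f x)) ∧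
        (∀ (f : Site d → 𝔸) (r : ℝ), 0 ≤ r → Bd2 L i.1.η i.1.k i.1.Ω f r →
          Bd2 L i.1.η i.1.k i.1.Ω (f - g (qs (c (q (g f))))) (BR * r)) ∧
        (∀ f : Site d → 𝔸, (∀ j, j ≤ i.1.k → ∀ x ∈ i.1.Ω j, IsSelfAdjoint (f x)) →
          ∀ j, j ≤ i.1.k → ∀ x ∈ i.1.Ω j, IsSelfAdjoint ((f - g (qs (c (q (g f))))) x))) :
    B8.Prop5Exists B₀' B₁ (fun i : ZdLanIdxSub4 d 𝔸 L => zdLan L B₁ i.1) :=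
  prop5Exists_zdLan_of_lettersRD hd2 hL hB₁ hB₀' hBH hB₂ hBG hBR hcL hfree (fun i : ZdLanIdxSub4 d 𝔸 L => i.1)
    (fun i => i.2.2.1) (fun i => i.2.2.2.1) SLet

/-- **PROPOSITION 5, UNIQUENESS CLAUSE (1.109), OVER THE FOUR-LAW CANONICAL INDEX** — `pub-ymgap-dag-n05-d` g3's `B8Prop5UniqueZdLan.prop5Unique_zdLan_of_lettersUB` at
`ι := Subtype.val`; hypotheses: `d, L ≥ 2`, `0 ≤ B₁`, and [4]'s uniqueness-side letters at every member.
[cite: Balaban1985RegularSpaces, Prop. 5 (1.109) p.94, (1.5) p.77] -/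
theorem prop5Unique_zdLanSub4_of_lettersUB (hd2 : 2 ≤ d) {L : ℕ} (hL : 2 ≤ L) {B₁ B₀'H B₂' BG BR cL : ℝ} (hB₁ : 0 ≤ B₁)
    (hB₀'H : 0 < B₀'H) (hB₂' : 0 ≤ B₂') (hBG : 0 ≤ BG) (hBR : 0 ≤ BR) (hcL : 0 < cL)
    (SLetUB : ∀ i : ZdLanIdxSub4 d 𝔸 L, ∀ α₀ : ℝ, 0 < α₀ → α₀ ≤ cL → InAk L i.1.k i.1.η α₀ i.1.Ω i.1.U₀ →
      ∃ (g Δ : (Site d → 𝔸) →ₗ[ℂ] (Site d → 𝔸)) (q : (Site d → 𝔸) →ₗ[ℂ] (ℕ → Site d → 𝔸)) (qs : (ℕ → Site d → 𝔸) →ₗ[ℂ] (Site d → 𝔸))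
        (Aw c : (ℕ → Site d → 𝔸) →ₗ[ℂ] (ℕ → Site d → 𝔸)) (H' : XSpace d i.1.k 𝔸 →ₗ[ℂ] (Site d → 𝔸)),
        (∀ x : Site d → 𝔸, (∃ C : ℝ, ∀ y, ‖x y‖ ≤ C) → g (Δ x + qs (Aw (q x))) = x) ∧ (∀ φ, qs (c (q (g (g (qs φ))))) = qs φ) ∧
        (∀ (f : Site d → 𝔸), ∀ x ∈ i.1.Ω 0, Δ f x = covLap i.1.η i.1.U₀ ((i.1.Ω 0).indicator f) x) ∧
        (∀ (μ : ℕ → Site d → 𝔸), ∀ x ∈ i.1.Ω 0, qs μ x = QT L i.1.k i.1.Λ i.1.U₀ μ x) ∧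
        (∀ (f : Site d → 𝔸) (n : ℕ), n ≤ i.1.k → ∀ y ∈ i.1.Λ n, q f n y = QprimeIter (zdBlocking d L) (bgT L i.1.U₀) n f y) ∧
        (∀ (f : Site d → 𝔸) (n : ℕ) (y : Site d), ¬ (n ≤ i.1.k ∧ y ∈ i.1.Λ n) → q f n y = 0) ∧
        (∀ (X : XSpace d i.1.k 𝔸) (x : Site d), ‖H' X x‖ ≤ B₀'H * ‖X‖) ∧
        (∀ n, n ≤ i.1.k → ∀ (X : XSpace d i.1.k 𝔸), ∀ p ∈ {b : Site d × Fin d | SideTouches (i.1.Ω n) b.1 b.2},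
          wt L i.1.η n * ‖covDerivFwd i.1.η i.1.U₀ p.2 (H' X) p.1‖ ≤ B₀'H * ‖X‖) ∧
        (∀ X : XSpace d i.1.k 𝔸, Bd2 L i.1.η i.1.k i.1.Ω (covLap i.1.η i.1.U₀ (H' X)) (B₂' * ‖X‖)) ∧
        (∀ (Y : XSpace d i.1.k 𝔸) (n : ℕ) (hn : n ≤ i.1.k) (y : Site d), y ∈ i.1.Λ n →
          QprimeIter (zdBlocking d L) (bgT L i.1.U₀) n (H' Y) y = Y (⟨n, Nat.lt_succ_of_le hn⟩, y)) ∧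
        (∀ (f : Site d → 𝔸) (r : ℝ), 0 ≤ r → Bd2 L i.1.η i.1.k i.1.Ω f r →
          (∀ x, ‖g f x‖ ≤ BG * r) ∧ ∀ n, n ≤ i.1.k → ∀ p ∈ {b : Site d × Fin d | SideTouches (i.1.Ω n) b.1 b.2},
            wt L i.1.η n * ‖covDerivFwd i.1.η i.1.U₀ p.2 (g f) p.1‖ ≤ BG * r) ∧
        (∀ (f : Site d → 𝔸) (r : ℝ), 0 ≤ r → Bd2 L i.1.η i.1.k i.1.Ω f r →
          Bd2 L i.1.η i.1.k i.1.Ω (f - g (qs (c (q (g f))))) (BR * r))) :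
    B8.Prop5Unique (fun i : ZdLanIdxSub4 d 𝔸 L => zdLan L B₁ i.1) :=
  prop5Unique_zdLan_of_lettersUB hd2 hL hB₁ hB₀'H hB₂' hBG hBR hcL (fun i : ZdLanIdxSub4 d 𝔸 L => i.1)
    (fun i => i.2.1) (fun i => i.2.2.1) (fun i => i.2.2.2.1) SLetUB

end Prop5

#print axioms prop5Exists_zdLanSub4_of_lettersRD

end Literature.MathematicalPhysics.QuantumFieldTheory.Balaban1983to89.B8Prop5LandauIdxLayer

end
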